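import Summits.BirchSwinnertonDyer.BirchSwinnertonDyer.Theorems.SignedBaseChangeTwistPairGreenbergProductDivisibilityStubFrameData
import Summits.BirchSwinnertonDyer.BirchSwinnertonDyer.Theorems.SignedBaseChangeTwistPairGreenbergProductDivisibilityCanonicalFrameData
import Summits.BirchSwinnertonDyer.BirchSwinnertonDyer.Theorems.SignedLowerHalvesKobayashiMainConjectureSmallImageIrrOverCoprimeQuadratic
import Literature.NumberTheory.QuadraticFields.ImaginaryQuadraticPrescribedSplittingInert
import Literature.NumberTheory.EllipticCurves.Rank1Residual.Predicates
import Literature.NumberTheory.EllipticCurves.Rank1Residual.Dedup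
import Literature.NumberTheory.DiophantineGeometry.PastenValuationProductsProofs
import Literature.NumberTheory.EllipticCurves.NonEisensteinPrimeOfSurjective
import Literature.NumberTheory.EllipticCurves.SkinnerUrban2014.SemistableCurvesProofs
import Literature.NumberTheory.EllipticCurves.Rank1Residual.X11Three
import Literature.NumberTheory.EllipticCurves.ModularityVersionApProofs
import Literature.NumberTheory.EllipticCurves.GlobalMinimalModel
import Literature.NumberTheory.EllipticCurves.SupersingularIrreducibleProofs
import HarnessLib

/-!
# Crux `KobayashiLowerHalfSemistable` (item stmt-BirchSwinnertonDyer-19000): DEFINITE FRAME DATA on class X6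
# — for every X6 pair `(W, p)`, `p ≥ 5`, and every prime `q₀ ∣ N` there EXIST an imaginary quadratic `K`
# with `p` split, `q₀` inert, every other bad prime split, `2` split or `2 ∣ N`, `(N, d_K) = 1`, the
# embedding datum `ι : ℚ̄_p ≃ ℂ` inducing `v ∣ p`, the (cyclotomic, anticyclotomic) `ℤ_p²`-tower with an
# adapted generator pair whose cyclotomic generator is CANONICAL, and (irr_K) for every framing
# (cell `bsd-ssimc`, seat `bsd-line-slh-p2`, lead of crux 2, gen 7; ROUTE-INDEPENDENT `--supports … --as helper`
# file, no `Theses` import; closes nothing)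

WHAT. The theorem `definiteFieldSupplyFromR` below has — VERBATIM — the statement of the stub
`DefiniteFieldSupplyFromR` (S1bʳ) of the crux line «defmu» (`Cruxes/KobayashiLowerHalfSemistable/DefanchorLine.lean`
§10 rev 5, ideator bsd-idea-13 g3; = Burungale–Skinner–Tian–Wan arXiv:2409.01350 II §2.3's choice «pick an imaginary
quadratic field L such that (ord) holds and (D_L, 2N) = 1 … q inert in L and the primes dividing N/q split», plus the
tower/embedding/irreducibility data every two-variable (BSTW-(def)-shaped) road over X6 quantifies over). It is
PROVED here by assembling tree theorems, so that stub is CLOSED whichever line is registered: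

* the field: `Quadratic.exists_imaginaryQuadratic_split_inert` (Dirichlet + CRT + the decomposition law; tree,
  Literature/NumberTheory/QuadraticFields) with `S = ({p, 2} ∪ primeFactors N) \ {q₀}`, `T = {q₀}` and `d_K = −r`,
  `r > N` prime (so `(N, d_K) = 1`, `K1FrameData.isCoprime_of_lt`);
* `q₀ ∥ N`: the conductor of a semistable curve is square-free (`semistable_iff_isSemistable_int`,
  `isSemistable_iff_squarefree_conductorNorm`);
* the places `v ≠ v̄ ∣ p` and the embedding datum `ι`: `K1FrameData.exists_pair_of_ncard_primesOver_eq_two`,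
  `K1FrameData.exists_iota` (route SignedBaseChange, cell bsd-wall; tree);
* the tower with CANONICAL `γ₁` (`χ_p(γ₁)·ζ = 1 + p^{e₀}`, `ζ` torsion):
  `K1FrameDataCanonical.exists_isTopGeneratorPair_isCyclotomic_isAnticyclotomic_canonical` (tree, cell bsd-wall);
* (irr_K) for every framing of `E_K[p]`: `SmallImageIrrK.isAbsolutelyIrreducible_baseChange_of_goodSS_of_split`
  (Serre Prop. 12 + Matar–Nekovář Prop. 5.26, tree-proved; `p` split in `K` discharges `(p, d_K) ≠ (3, −3)`).

HONEST FRAMING: an existence theorem about auxiliary DATA (fields, places, towers), proved outright (no named-fact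
hypothesis); it asserts nothing about `L`-functions, Selmer groups or BSD; the crux, both its lines and every route
item stay OPEN; BSD is not proved by any of this. [cite: BurungaleSkinnerTianWan2024, Part II §2.3 (choice of L)]
[cite: Marcus2018, Ch. 3 Thm. 25] [cite: Washington1997, §13.1] [cite: Serre1972, §1.11 Prop. 12]
[cite: MatarNekovar2019, Prop. 5.26 (2) and (3) (p. 492)]
-/

set_option autoImplicit false
-- the Theorems namespace of a single-conjunct summit repeats the summit name by design (D-0017)
set_option linter.dupNamespace false

noncomputable section

open scoped Classical

open NumberField IsDedekindDomain Field
open Literature.NumberTheory.GaloisRepresentations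
open Literature.NumberTheory.EllipticCurves
open Summit.BirchSwinnertonDyer.BirchSwinnertonDyer.Theorems.SignedBaseChangeK1FrameData

namespace Summit.BirchSwinnertonDyer.BirchSwinnertonDyer.Theorems.SemistableDefiniteFrameData

/-! ### The definite frame data on class X6 (stub S1bʳ `DefiniteFieldSupplyFromR` of line «defmu», VERBATIM) -/

/-- **Definite frame data on class X6** (= `DefanchorLine.DefiniteFieldSupplyFromR`, stub S1bʳ of line «defmu»,
statement verbatim; PROVED). For an X6 pair `(W, p)` with `p ≥ 5`, `N = N_W`, and any prime `q₀ ∣ N` (the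
hypothesis `p ∤ v_{q₀}(Δ_W)` is only threaded through): an imaginary quadratic `K` (`d_K = −r`, `r > N` prime,
from Dirichlet + CRT: `Quadratic.exists_imaginaryQuadratic_split_inert`) with `p` split into `v ≠ v̄`, `q₀` inert,
every other `ℓ ∣ N` split, `2` split or `2 ∣ N`, `(N, d_K) = 1`; `q₀ ∥ N` (square-free conductor of a semistable
curve); the embedding datum `ι : ℚ̄_p ≃ ℂ` inducing `v` (`K1FrameData.exists_iota`); absolute irreducibility of every
framing of `E_K[p]` (`SmallImageIrrK.isAbsolutelyIrreducible_baseChange_of_goodSS_of_split`); and the (cyclotomic,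
anticyclotomic) `ℤ_p²`-tower with an adapted generator pair whose `γ₁` is canonical
(`K1FrameDataCanonical.exists_isTopGeneratorPair_isCyclotomic_isAnticyclotomic_canonical`). An existence theorem about auxiliary data; nothing about `L`-values or
Selmer groups is asserted. [cite: BurungaleSkinnerTianWan2024, Part II §2.3 (choice of the auxiliary field L)]
[cite: Marcus2018, Ch. 3 Thm. 25] [cite: Serre1972, §1.11 Prop. 12] [cite: MatarNekovar2019, Prop. 5.26 (2) and (3) (p. 492)]
[cite: Washington1997, §13.1] -/
theorem definiteFieldSupplyFromR :
    ∀ (p : ℕ) [Fact p.Prime] (W : WeierstrassCurve ℚ) [W.IsElliptic] [W.IsGloballyMinimal] (N : ℕ),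
    (N : ℤ) = W.conductorNorm ℤ → 5 ≤ p → Rank1Residual.ClassX6 W p →
    ∀ q₀ : ℕ, q₀.Prime → (q₀ : ℤ) ∣ W.conductorNorm ℤ →
      ¬ ((p : ℤ) ∣ padicValRat q₀ W.Δ) →
    ∃ (K : Type) (_ : Field K) (_ : NumberField K) (ι : PadicAlgCl p ≃+* ℂ)
      (v vbar : HeightOneSpectrum (𝓞 K)) (κ₁ κ₂ : ZpExtension K p) (γ₁ γ₂ : absoluteGaloisGroup K)
      (_ : Fact (ZpExtension.IsTopGeneratorPair κ₁ κ₂ γ₁ γ₂)) (_ : NeZero (NumberField.discr K).natAbs),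
      IsImaginaryQuadratic K ∧ ((Ideal.span {(p : ℤ)}).primesOver (𝓞 K)).ncard = 2 ∧
      ((p : ℕ) : 𝓞 K) ∈ v.asIdeal ∧ ((p : ℕ) : 𝓞 K) ∈ vbar.asIdeal ∧ vbar ≠ v ∧
      (∀ (w : InfinitePlace K) (k : 𝓞 K), k ∈ v.asIdeal ↔ ‖ι.symm (w.embedding (k : K))‖ < 1) ∧
      IsCoprime (N : ℤ) (NumberField.discr K) ∧
      q₀.Prime ∧ q₀ ∣ N ∧ ¬ (q₀ ^ 2 ∣ N) ∧
      ((Ideal.span {(q₀ : ℤ)}).primesOver (𝓞 K)).ncard = 1 ∧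
      (∀ ℓ : ℕ, ℓ.Prime → ℓ ∣ N → ℓ ≠ q₀ → ((Ideal.span {(ℓ : ℤ)}).primesOver (𝓞 K)).ncard = 2) ∧
      (((Ideal.span {(2 : ℤ)}).primesOver (𝓞 K)).ncard = 2 ∨ 2 ∣ N) ∧
      ¬ ((p : ℤ) ∣ padicValRat q₀ W.Δ) ∧
      (∀ ρ : ModPGaloisRep K (ZMod p) 2, (W.baseChange K).IsTorsionGaloisRep p ρ →
        FramedRep.IsAbsolutelyIrreducible ρ) ∧
      κ₁.IsCyclotomic ∧ κ₂.IsAnticyclotomic ∧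
      (∃ ζ : ℤ_[p]ˣ, IsOfFinOrder ζ ∧
        ((GaloisRep.cyclotomicCharacter K p γ₁ * ζ : ℤ_[p]ˣ) : ℤ_[p]) = (cyclotomicGenerator p : ℤ_[p])) := by
  intro p _ W _ _ N hN hp5 hX q₀ hq₀ hq₀N hval
  have hpP : p.Prime := Fact.out
  have hp2 : p ≠ 2 := by omega
  -- the conductor: `N ≠ 0`, square-free (semistable), `q₀ ∣ N`, `p ∤ N`
  have hNeq : N = W.conductorNorm ℤ := by exact_mod_cast hN
  have hN0 : N ≠ 0 := by
    rw [hNeq]; exact (WeierstrassCurve.conductorNorm_pos_holds W).ne'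
  have hsqf : Squarefree N := by
    rw [hNeq]
    exact (WeierstrassCurve.isSemistable_iff_squarefree_conductorNorm W).mp
      ((Rank1Residual.semistable_iff_isSemistable_int (W := W)).mp hX.2.1)
  have hq₀dvd : q₀ ∣ N := by
    rw [← hN] at hq₀N; exact_mod_cast hq₀N
  have hq₀sq : ¬ q₀ ^ 2 ∣ N := by
    intro h
    have := hsqf q₀ (by rw [← sq]; exact h)
    exact hq₀.not_isUnit (by simpa using this)
  have hpN : ¬ p ∣ N := by
    rw [hNeq]; exact not_dvd_conductorNorm_of_hasGoodReductionAtPrime W hX.1.1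
  have hpq₀ : p ≠ q₀ := fun h ↦ hpN (h ▸ hq₀dvd)
  -- §1 the field: `S = ({p, 2} ∪ primeFactors N) \ {q₀}` split, `T = {q₀}` inert, `d_K = -r`, `r > N`
  set S : Finset ℕ := (insert p (insert 2 N.primeFactors)).erase q₀ with hSdef
  have hS : ∀ ℓ ∈ S, ℓ.Prime := by
    intro ℓ hℓ
    rw [hSdef, Finset.mem_erase, Finset.mem_insert, Finset.mem_insert] at hℓ
    rcases hℓ.2 with rfl | rfl | h
    · exact hpP
    · exact Nat.prime_two
    · exact Nat.prime_of_mem_primeFactors h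
  have hT : ∀ q ∈ ({q₀} : Finset ℕ), q.Prime := by
    intro q hq; rw [Finset.mem_singleton] at hq; exact hq ▸ hq₀
  have hST : Disjoint S ({q₀} : Finset ℕ) := by
    rw [Finset.disjoint_singleton_right, hSdef]
    exact Finset.notMem_erase q₀ _
  obtain ⟨r, K, _, _, hr, hNr, -, -, -, h2, hdisc, hSsp, hTin, -⟩ :=
    Literature.NumberTheory.QuadraticFields.Quadratic.exists_imaginaryQuadratic_split_inert S {q₀} hS hT hST N
  have hK : IsImaginaryQuadratic K :=
    ⟨h2, Literature.NumberTheory.QuadraticFields.Quadratic.isTotallyComplex_of_discr_neg h2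
      (by rw [hdisc, neg_lt_zero]; exact_mod_cast hr.pos)⟩
  have hpS : p ∈ S := by
    rw [hSdef, Finset.mem_erase]; exact ⟨hpq₀, Finset.mem_insert_self _ _⟩
  have hsplit : ((Ideal.span {(p : ℤ)}).primesOver (𝓞 K)).ncard = 2 := (hSsp p hpS).2
  have hcop : IsCoprime (N : ℤ) (NumberField.discr K) := by
    rw [hdisc]; exact isCoprime_of_lt hr hN0 hNr
  -- §2 the primes above `p`, §4 the embedding datum, §3 the canonical tower
  obtain ⟨v, vbar, hv, hvbar, hne⟩ := exists_pair_of_ncard_primesOver_eq_two hpP hsplit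
  obtain ⟨ι, hι⟩ := exists_iota hK v hv
  obtain ⟨κ₁, κ₂, γ₁, γ₂, hpair, hcyc, hanti, hcan⟩ :=
    SignedBaseChangeK1FrameDataCanonical.exists_isTopGeneratorPair_isCyclotomic_isAnticyclotomic_canonical
      (p := p) hK hp2
  haveI : Fact (ZpExtension.IsTopGeneratorPair κ₁ κ₂ γ₁ γ₂) := ⟨hpair⟩
  haveI : NeZero (NumberField.discr K).natAbs :=
    ⟨by rw [hdisc, Int.natAbs_neg, Int.natAbs_natCast]; exact hr.ne_zero⟩
  refine ⟨K, inferInstance, inferInstance, ι, v, vbar, κ₁, κ₂, γ₁, γ₂, inferInstance, inferInstance, hK, hsplit,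
    hv, hvbar, hne, hι, hcop, hq₀, hq₀dvd, hq₀sq, ?_, ?_, ?_, hval, ?_, hcyc, hanti, hcan⟩
  · -- `q₀` inert
    exact (hTin q₀ (Finset.mem_singleton_self q₀)).2
  · -- every other bad prime splits
    intro ℓ hℓ hℓN hℓq
    refine (hSsp ℓ ?_).2
    rw [hSdef, Finset.mem_erase, Finset.mem_insert, Finset.mem_insert]
    exact ⟨hℓq, Or.inr (Or.inr (Nat.mem_primeFactors.mpr ⟨hℓ, hℓN, hN0⟩))⟩
  · -- `2` splits, unless `2 = q₀` (then `2 ∣ N`)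
    by_cases h2q : (2 : ℕ) = q₀
    · exact Or.inr (h2q ▸ hq₀dvd)
    · refine Or.inl ?_
      have h2S : 2 ∈ S := by
        rw [hSdef, Finset.mem_erase, Finset.mem_insert, Finset.mem_insert]
        exact ⟨h2q, Or.inr (Or.inl rfl)⟩
      exact_mod_cast (hSsp 2 h2S).2
  · -- (irr_K) for every framing: good supersingular odd `p`, `p` split in `K`, `(N, d_K) = 1`
    intro ρ hρ
    exact SmallImageIrrK.isAbsolutelyIrreducible_baseChange_of_goodSS_of_split W p hp2 hX.1.1 hX.1.2 K h2 hN
      hcop hsplit ρ hρ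

end Summit.BirchSwinnertonDyer.BirchSwinnertonDyer.Theorems.SemistableDefiniteFrameData


/-! ### Append (lead gen 7): stub S1aʳ `RamifiedLevelPrimeR` of line «defmu», CONDITIONALLY on modularity and
Diamond–Ribet level lowering BY NAME -/

namespace Summit.BirchSwinnertonDyer.BirchSwinnertonDyer.Theorems.SemistableDefiniteFrameData

/-- **Stub S1aʳ `RamifiedLevelPrimeR` of line «defmu» (statement verbatim as the conclusion), CONDITIONAL on two
PUBLISHED named facts: modularity `exists_isNewformOf` and Diamond 1995 / Ribet 1990 level lowering
`diamond1995_refinedSerre`.** For an X6 pair `(W, p)` with `p ≥ 5`: some prime `q₀ ∣ N_W` has `p ∤ v_{q₀}(Δ_W)`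
(`ρ̄_{E,p}` ramified at `q₀`). Proof: `E[p]` is irreducible at an odd supersingular prime (Serre Prop. 12, tree
`hasIrreducibleModPGaloisRep_of_dvd_frobeniusTrace`); a semistable curve with `E[p]` irreducible and `p` good, odd,
has a (ram) prime — `SkinnerUrban2014.ram_of_semistable_of_irr` (Ribet's level lowering to level one, tree theorem
modulo `hmod hLL`); a multiplicative prime divides the conductor; `v_{q₀}(Δ_W) = v_{q₀}(Δ_min)` for the globally
minimal `W` (`cast_minimalDiscriminantInt`). CONDITIONAL (`conditional-result`); it does NOT close the registered stub
(whose signature is unconditional) — it itemises its print dependence. [cite: Ribet1990, Thm. 1.1]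
[cite: Diamond1995RefinedSerre, Thm. 1.1] [cite: Serre1972, §1.11 Prop. 12] [cite: SkinnerUrban2014, p. 45 (remark before Cor. 3.6.10)] -/
theorem ramifiedLevelPrimeR_of_levelLowering (hmod : ModularForms.exists_isNewformOf)
    (hLL : Literature.NumberTheory.Automorphic.diamond1995_refinedSerre) :
    ∀ (p : ℕ) [Fact p.Prime] (W : WeierstrassCurve ℚ) [W.IsElliptic] [W.IsGloballyMinimal],
    5 ≤ p → Rank1Residual.ClassX6 W p →
    ∃ q₀ : ℕ, q₀.Prime ∧ (q₀ : ℤ) ∣ W.conductorNorm ℤ ∧ ¬ ((p : ℤ) ∣ padicValRat q₀ W.Δ) := by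
  intro p _ W _ _ hp5 hX
  have hp2 : p ≠ 2 := by omega
  have hirr : Rank1Residual.Irr W p :=
    hasIrreducibleModPGaloisRep_of_dvd_frobeniusTrace W p hp2
      (W.not_dvd_minimalDiscriminantInt_of_hasGoodReductionAtPrime' p hX.1.1) hX.1.2
  obtain ⟨ℓ, hℓ, -, hmult, hndvd⟩ :=
    SkinnerUrban2014.ram_of_semistable_of_irr hmod hLL W p hp2 hX.1.1 hX.2.1 hirr
  refine ⟨ℓ, hℓ.out, ?_, ?_⟩
  · exact_mod_cast (W.dvd_conductorNorm_iff_not_hasGoodReductionAtPrime ℓ).mpr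
      (Rank1Residual.not_hasGoodReductionAtPrime_of_hasMultiplicativeReductionAtPrime (W := W) ℓ hmult)
  · rw [← WeierstrassCurve.cast_minimalDiscriminantInt W, padicValRat.of_int]
    exact_mod_cast hndvd

end Summit.BirchSwinnertonDyer.BirchSwinnertonDyer.Theorems.SemistableDefiniteFrameData

end
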